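import Mathlib
import Literature.Geometry.Lorentzian.Basic
import Literature.Geometry.Riemannian.ThreeShrinkerClassification
import Summits.SmoothPoincare4.SmoothPoincare4.Theses.EntropyRung
import HarnessLib

/-!
# Stub `stub_threeShrinkerGap` of line `collapsed-ends-usc` — closed MODULO the classification of
# three-dimensional gradient shrinking Ricci solitons (named fact `threeShrinkerClassification_modelData`)

Crux `EntropyRung.NoncompactShrinkerGap` (stmt-SmoothPoincare4-10868), line `collapsed-ends-usc`,
registered stub `stub_threeShrinkerGap` — "the rung one dimension down": every complete connected
non-flat normalised three-dimensional gradient shrinking Ricci soliton `(N, h, φ)`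
(`Ric + Hess φ = h/2`, `R + |∇φ|² = φ`, `R ≢ 0`; compact ALLOWED) has
`∫_N e^{-φ} dV_h ≤ 16π² e^{-3/2} = (4π)^{3/2} Θ₃(S³)`, the hypothesis `hA` of the line's composition
`NoncompactShrinkerGap_of` (used only through `2√π · 16π²e^{-3/2} = 32π²√π e^{-3/2}`).

Mathematically the stub is the classification of complete 3-dimensional gradient shrinkers WITHOUT
curvature assumptions (Ivey 1993 — compact case; Perelman 2003; Ni–Wallach 2008; Naber 2010;
Cao–Chen–Zhu 2008, Prop. 4.7 — complete noncompact non-flat ⇒ quotient of the round neck; stated in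
one line by Munteanu–Wang, arXiv:1606.01861, Thm. 1.2: "isometric to `ℝ³` or to a quotient of the
sphere `S³` or of the cylinder `ℝ × S²`") followed by three model evaluations:
`S³(2)/Γ`: `∫ e^{-φ} = 16π² e^{-3/2}/|Γ|` (EQUALITY iff `Γ = 1`); `S²(√2) × ℝ`: `16π√π e^{-1} ≈ 32.8 <
35.2`; its `ℤ₂`-quotients: half of that. The classification is a deep printed theorem whose models are
not yet Riemannian manifolds of the tree (no finite Riemannian quotients `S³/Γ`, no product manifold
`S² × ℝ` — the 4-d cylinder exists as the conformally flat `RoundCylinderFour*.lean` —, no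
`Vol(S³) = 2π²` for `riemannianMeasure`); per the NEED-A-PUBLISHED-FACT protocol it was written inline
in the first proposal of this file and RELOCATED by the gate (p85139) to the named fact
`Literature.Geometry.Riemannian.threeShrinkerClassification_modelData`
(`Literature/Geometry/Riemannian/ThreeShrinkerClassification.lean`): over the stub's binder minus
non-flatness, the printed theorem's immediate consequence for the data of a normalised shrinker — a
structural tetrachotomy `ℝ³` / `S³(2)/Γ` / `S²(√2) × ℝ` / `(S²(√2) × ℝ)/ℤ₂` with the model constants
(NOT the stub's inequality). This file PROVES the stub from it — `stub_threeShrinkerGap_of_classification :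
threeShrinkerClassification_modelData → <registered signature of stub_threeShrinkerGap, verbatim>`,
registered on the crux as a sub-goal of that name: case `S³/Γ`: `lintegral_const`,
`e^{-3/2} · 16π²/k ≤ 16π² e^{-3/2}`; cylinder cases: the real inequality
`16π√π e^{-1} ≤ 16π² e^{-3/2} ⟺ e ≤ π` (`Real.exp_one_lt_d9`, `Real.pi_gt_d2`); the flat case contradicts
`R ≢ 0`. The unconditional registered signature `stub_threeShrinkerGap` is therefore closed modulo
`threeShrinkerClassification_modelData` only (no `_holds` in the tree).

## References

* O. Munteanu, J. Wang, *Structure at infinity for shrinking Ricci solitons*, arXiv:1606.01861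
  (Ann. Sci. ÉNS 52 (2019) 891–925), Thm. 1.2 (p. 3) and the history paragraph following it; proof of
  Thm. 5.1 (p. 21: "`(N, h)` is a normalized three dimensional gradient shrinking Ricci soliton.
  Theorem 1.2 implies that `(N, h)` is isometric to a quotient of either `S³` or `ℝ × S²` … where `N`
  is either `ℝ × S²` or its `ℤ₂` quotient. Since the weighted volume of `N` …"). READ.
  [MunteanuWang2016, MunteanuWang2019]
* H.-D. Cao, B.-L. Chen, X.-P. Zhu, *Recent developments on Hamilton's Ricci flow*, Surveys in
  Differential Geometry XII (2008), 47–112: Lemma 4.6 (p. 77, Perelman), Prop. 4.7 (p. 78). READ.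
  [CaoChenZhu2007]
* T. Ivey, *Ricci solitons on compact three-manifolds*, Diff. Geom. Appl. 3 (1993) 301–307, Thm. 1
  (abstract: "there are no compact three-dimensional Ricci solitons other than spaces of constant
  curvature"). [Ivey1993]
* H.-D. Cao, R. S. Hamilton, T. Ilmanen, arXiv:math/0404165 (2004), §§3–4 (Gaussian densities
  `Θ(S³) = Θ(S³ × ℝ) = 2√π e^{-3/2}`). [CaoHamiltonIlmanen2004]
-/

noncomputable section

-- the prescribed namespace `Summit.<Summit>.<Problem>.…` repeats `SmoothPoincare4` (summit = problem)
set_option linter.dupNamespace false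

namespace Summit.SmoothPoincare4.SmoothPoincare4.Theorems.NoncompactShrinkerGapThreeShrinkerGap

open scoped Manifold ContDiff ENNReal NNReal
open MeasureTheory Set
open Literature.Geometry.Lorentzian Literature.Geometry.Riemannian

/-! ## Arithmetic of the model constants -/

/-- **`e ≤ π` in the form the cylinder needs**: `16π√π e^{-1} ≤ 16π² e^{-3/2}`, i.e. the weighted
volume `(4π)^{3/2} Θ₃(S² × ℝ)` of the shrinking round cylinder `S²(√2) × ℝ` is at most the weighted
volume `(4π)^{3/2} Θ₃(S³)` of the shrinking round sphere `S³(2)` (`⟺ e^{1/2} ≤ √π ⟺ e ≤ π`; ratio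
`e^{1/2}/√π ≈ .930`). Dividing by `(4π)^{3/2} = 8π√π` this is `Θ₃(S² × ℝ) = 2/e ≤ Θ₃(S³) = 2√π e^{-3/2}`,
i.e. the entries `.736 < .791` (`= Θ₄(S²×ℝ²) < Θ₄(S³×ℝ)`) of Cao–Hamilton–Ilmanen's density table
(2004, §3). [cite: CaoHamiltonIlmanen2004, §3] -/
theorem cylinderThreeWeightedVolume_le_sphereThreeWeightedVolume :
    16 * Real.pi * Real.sqrt Real.pi * Real.exp (-1) ≤
      16 * Real.pi ^ 2 * Real.exp (-(3 : ℝ) / 2) := by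
  have hπ : Real.exp 1 < Real.pi := lt_trans Real.exp_one_lt_d9 (by linarith [Real.pi_gt_d2])
  have h1 : Real.exp (1 / 2) ≤ Real.sqrt Real.pi := by
    rw [Real.le_sqrt (Real.exp_pos _).le Real.pi_pos.le, ← Real.exp_nat_mul]
    norm_num
    exact hπ.le
  have h2 : Real.exp (-1) = Real.exp (-(3 : ℝ) / 2) * Real.exp (1 / 2) := by
    rw [← Real.exp_add]
    norm_num
  have hsq : Real.sqrt Real.pi * Real.sqrt Real.pi = Real.pi := Real.mul_self_sqrt Real.pi_pos.le
  have hπ0 : 0 ≤ Real.pi := Real.pi_pos.le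
  have hs0 : 0 ≤ Real.sqrt Real.pi := Real.sqrt_nonneg _
  rw [h2]
  calc 16 * Real.pi * Real.sqrt Real.pi * (Real.exp (-(3 : ℝ) / 2) * Real.exp (1 / 2))
      = 16 * Real.pi * Real.exp (-(3 : ℝ) / 2) * (Real.sqrt Real.pi * Real.exp (1 / 2)) := by ring
    _ ≤ 16 * Real.pi * Real.exp (-(3 : ℝ) / 2) * (Real.sqrt Real.pi * Real.sqrt Real.pi) := by
        gcongr
    _ = 16 * Real.pi ^ 2 * Real.exp (-(3 : ℝ) / 2) := by rw [hsq]; ring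

/-- The `ℤ₂`-quotients of the cylinder have half its weighted volume: `8π√π e^{-1} ≤ 16π² e^{-3/2}`.
[cite: CaoHamiltonIlmanen2004, §3] -/
theorem halfCylinderThreeWeightedVolume_le_sphereThreeWeightedVolume :
    8 * Real.pi * Real.sqrt Real.pi * Real.exp (-1) ≤
      16 * Real.pi ^ 2 * Real.exp (-(3 : ℝ) / 2) := by
  refine le_trans ?_ cylinderThreeWeightedVolume_le_sphereThreeWeightedVolume
  have : 0 ≤ Real.pi * Real.sqrt Real.pi * Real.exp (-1) := by positivity
  nlinarith

/-- The round space form `S³(2)/Γ`, `|Γ| = k ≥ 1`, has weighted volume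
`e^{-3/2} · 16π²/k ≤ 16π² e^{-3/2}`, with equality iff `k = 1`. [cite: CaoHamiltonIlmanen2004, §3] -/
theorem sphereQuotientThreeWeightedVolume_le {k : ℕ} (hk : 0 < k) :
    Real.exp (-(3 : ℝ) / 2) * (16 * Real.pi ^ 2 / k) ≤ 16 * Real.pi ^ 2 * Real.exp (-(3 : ℝ) / 2) := by
  have hk1 : (1 : ℝ) ≤ k := by exact_mod_cast hk
  have hle : 16 * Real.pi ^ 2 / k ≤ 16 * Real.pi ^ 2 := div_le_self (by positivity) hk1
  calc Real.exp (-(3 : ℝ) / 2) * (16 * Real.pi ^ 2 / k)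
      ≤ Real.exp (-(3 : ℝ) / 2) * (16 * Real.pi ^ 2) :=
        mul_le_mul_of_nonneg_left hle (Real.exp_pos _).le
    _ = 16 * Real.pi ^ 2 * Real.exp (-(3 : ℝ) / 2) := by ring

/-! ## The stub, closed modulo the classification -/

/-- **Stub `stub_threeShrinkerGap` (line `collapsed-ends-usc` of crux `EntropyRung.NoncompactShrinkerGap`),
CLOSED MODULO the named fact `Literature.Geometry.Riemannian.threeShrinkerClassification_modelData`**
(registered on the crux as the sub-goal `stub_threeShrinkerGap_of_classification : <fact> → <signature of
stub_threeShrinkerGap, verbatim>`; the skeleton's `sorry` for `stub_threeShrinkerGap` closes by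
`stub_threeShrinkerGap_of_classification threeShrinkerClassification_modelData_holds` once that `_holds`
theorem exists): every complete connected non-flat normalised three-dimensional gradient
shrinking Ricci soliton `(N, h, φ)` has `∫_N e^{-φ} dV_h ≤ 16π² e^{-3/2} = (4π)^{3/2} Θ₃(S³)`. Proof:
the Gaussian case (o) of the classification is excluded by `R ≢ 0`; in case (a) (`S³(2)/Γ`)
`∫ e^{-φ} = e^{-3/2} Vol = e^{-3/2} · 16π²/k ≤ 16π² e^{-3/2}` (`lintegral_const`; EQUALITY iff `k = 1`);
in cases (b), (c) (cylinder and its `ℤ₂`-quotients) the value `16π√π e^{-1}` resp. `8π√π e^{-1}` is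
below the bound because `e ≤ π`. [cite: MunteanuWang2016, Thm 1.2 (p. 3)] -/
theorem stub_threeShrinkerGap_of_classification : Literature.Geometry.Riemannian.threeShrinkerClassification_modelData → ∀ (N : Type) [TopologicalSpace N] [T2Space N] [SecondCountableTopology N] [ChartedSpace E3 N] [IsManifold (𝓡 3) ∞ N] [ConnectedSpace N] [T3Space N] [MeasurableSpace N] [BorelSpace N] (h : PseudoRiemannianMetric (𝓡 3) ∞ E3 (TangentSpace (𝓡 3) : N → Type _)) [h.HasLeviCivita] (φ : N → ℝ) (hh : h.IsRiemannian), (∀ (x : N) (r : NNReal), IsCompact {y : N | h.edist hh x y ≤ r}) → ContMDiff (𝓡 3) 𝓘(ℝ, ℝ) ∞ φ → (∀ (x : N) (X Y : TangentSpace (𝓡 3) x), h.ricci x X Y + h.hessian φ x X Y = (1 / 2 : ℝ) * h.val x X Y) → (∀ x : N, h.scalarCurvature x + h.gradSq φ x = φ x) → (∃ x : N, h.scalarCurvature x ≠ 0) → ∫⁻ x, ENNReal.ofReal (Real.exp (-φ x)) ∂(riemannianMeasure (h.toContMDiffRiemannianMetric hh)) ≤ ENNReal.ofReal (16 * Real.pi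 ^ 2 * Real.exp (-(3 : ℝ) / 2)) := by
  intro hcl N _ _ _ _ _ _ _ _ _ h _ φ hh hcpl hφ hsol hnorm hnf
  rcases hcl N h φ hh hcpl hφ hsol hnorm with
    ⟨hflat, -⟩ | ⟨-, -, hconst, k, hk, hvol⟩ | ⟨-, hcyl⟩ | ⟨-, hhalf⟩
  · -- (o) the Gaussian soliton is flat, excluded by `R ≢ 0`
    obtain ⟨x, hx⟩ := hnf
    exact absurd (hflat x) hx
  · -- (a) `S³(2)/Γ`: `φ ≡ 3/2`, `Vol = 16π²/k`
    have h32 : ∀ x : N, ENNReal.ofReal (Real.exp (-φ x)) = ENNReal.ofReal (Real.exp (-(3 : ℝ) / 2)) := by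
      intro x
      rw [hconst x, neg_div]
    rw [lintegral_congr h32, lintegral_const, hvol, ← ENNReal.ofReal_mul (Real.exp_pos _).le]
    exact ENNReal.ofReal_le_ofReal (sphereQuotientThreeWeightedVolume_le hk)
  · -- (b) the cylinder `S²(√2) × ℝ`
    rw [hcyl]
    exact ENNReal.ofReal_le_ofReal cylinderThreeWeightedVolume_le_sphereThreeWeightedVolume
  · -- (c) its `ℤ₂`-quotients
    rw [hhalf]
    exact ENNReal.ofReal_le_ofReal halfCylinderThreeWeightedVolume_le_sphereThreeWeightedVolume

/-- The line's named statement `ThreeShrinkerGap` (skeleton `Cruxes/NoncompactShrinkerGap/Lines/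
collapsed_ends_usc.lean`, def unfolded = the registered stub) follows from the classification: a
restatement of `stub_threeShrinkerGap_of_classification` with the model space spelled
`EuclideanSpace ℝ (Fin 3)`, for users outside this namespace. [cite: MunteanuWang2016, Thm 1.2 (p. 3)] -/
theorem threeShrinkerGap_of_classification
    (hcl : Literature.Geometry.Riemannian.threeShrinkerClassification_modelData) :
    ∀ (N : Type) [TopologicalSpace N] [T2Space N] [SecondCountableTopology N]
      [ChartedSpace (EuclideanSpace ℝ (Fin 3)) N] [IsManifold (𝓡 3) ∞ N] [ConnectedSpace N] [T3Space N]
      [MeasurableSpace N] [BorelSpace N]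
      (h : PseudoRiemannianMetric (𝓡 3) ∞ (EuclideanSpace ℝ (Fin 3)) (TangentSpace (𝓡 3) : N → Type _))
      [h.HasLeviCivita] (φ : N → ℝ) (hh : h.IsRiemannian),
      (∀ (x : N) (r : NNReal), IsCompact {y : N | h.edist hh x y ≤ r}) →
      ContMDiff (𝓡 3) 𝓘(ℝ, ℝ) ∞ φ →
      (∀ (x : N) (X Y : TangentSpace (𝓡 3) x),
        h.ricci x X Y + h.hessian φ x X Y = (1 / 2 : ℝ) * h.val x X Y) →
      (∀ x : N, h.scalarCurvature x + h.gradSq φ x = φ x) →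
      (∃ x : N, h.scalarCurvature x ≠ 0) →
      ∫⁻ x, ENNReal.ofReal (Real.exp (-φ x)) ∂(riemannianMeasure (h.toContMDiffRiemannianMetric hh)) ≤
        ENNReal.ofReal (16 * Real.pi ^ 2 * Real.exp (-(3 : ℝ) / 2)) :=
  stub_threeShrinkerGap_of_classification hcl

end Summit.SmoothPoincare4.SmoothPoincare4.Theorems.NoncompactShrinkerGapThreeShrinkerGap

end
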